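import Summits.HodgeConjecture.HodgeConjecture.Theorems.F0P3StubS5Fold
import Literature.NumberTheory.Automorphic.UnitaryGroupCotangentSpectralProjection
import HarnessLib

/-!
# Crux `H413`, line `F0_U3CohMultOne` — STUB S5 from the THREE LETTERS BY NAME: E2′ `hodgeTypeRigid`, (D) `holCotFormSpectralProjection`,
# `antiholCotFormSpectralProjection`

Floor-0 programme P3 «U3-mult», seat F0P3-p02 (g0); crux item stmt-HodgeConjecture-24833 (`HCCMUnconditional.H413`).
HC_CM is proved only modulo the printed citations until rung 0 closes.

`stubS5_of_letters` = ★ `F0P3StubS5Fold.stubS5_of_spectralProjection` with its two inline TP⁺ hypotheses DISCHARGED BY NAME from the typer's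
letter file ★ `Literature/NumberTheory/Automorphic/UnitaryGroupCotangentSpectralProjection.lean` (p792838; REF1 kernel cert
`CertS5ByLetterNames.lean`, F0/P3 bus 2026-08-30T22:29:43Z: the filed bodies and the fold's binders are the same terms after elaboration).
Remaining hypotheses: the engine letter E2′ ★ `Literature.NumberTheory.Rogawski1990.hodgeTypeRigid` (a named fact — CONDITIONAL RESULT until
the engine proves it) and the continuity of cohomological cotangent forms on `U(V)(𝔸_{F⁺})` (`hcont`, A-p09's ★-pending
`Theorems/H413CohFormsContinuous.continuous_apply_of_mem_cohForms`, whose statement is this binder's type verbatim).  Conclusion = the body of the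
registered stub `StubS5HodgeTypeExclusionAt` (`Cruxes/H413/Lines/F0_U3CohMultOne.lean` v1.1 ll. 239–251) TOKEN-IDENTICALLY.

References: [Rogawski1990] Thm. 13.3.6 (c), §15.3 ¶1, §12.3 p. 174, Thm. 14.6.4, Thm. 13.3.5; [BorelJacquet1979] §4.6; [Borel1997] Thm. 2.13, §8.4;
[Liu2021] proof of Prop. 4.13 l. 2140–2146, Lem. D.2 (2).
-/

-- the mandated namespace repeats `HodgeConjecture.HodgeConjecture`, as in every `Theorems/*.lean` of this sub-problem
set_option linter.dupNamespace false

noncomputable section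

namespace Summit.HodgeConjecture.HodgeConjecture.Cruxes.H413.F0P3StubS5Fold

open scoped TensorProduct Matrix InnerProductSpace ENNReal ComplexOrder
open MeasureTheory
open NumberField NumberField.InfinitePlace IsDedekindDomain
open HodgeCM.Model HodgeCM.Model.LiuIndex HodgeCM.Model.TowerCarrier
open Summit.HodgeConjecture.CorCM.Model
open Literature.AlgebraicGeometry.Motives (CMType AbelianVariety)
open Literature.AlgebraicGeometry.HodgeTheory Literature.NumberTheory.Automorphic.PicardCM
open Literature.AlgebraicGeometry.ShimuraVarieties Literature.AlgebraicGeometry.ShimuraVarieties.UnitaryCanonicalModel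
open Literature.NumberTheory.ComplexMultiplication
open Literature.NumberTheory.Automorphic
open Literature.NumberTheory.Automorphic.Liu2021 Literature.NumberTheory.Automorphic.Liu2021.AppendixC
open Literature.NumberTheory.Automorphic.Liu2021.Def411WeilCarriers (lineOf locF Rep)
open Summit.HodgeConjecture.CorCM.Transposition.OmegaTransport (realUnit)
open HodgeCM.Model.ArchSideTerm (e₁)
open Literature.NumberTheory.GelbartRogawski1991 Literature.NumberTheory.GelbartRogawski1991.UnitaryDualPair
open Literature.RepresentationTheory Literature.RepresentationTheory.Liu2021
open Summit.HodgeConjecture.CorCM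
open Summit.HodgeConjecture.CorCM.Transposition
open Literature.NumberTheory.GelbartRogawski1991.OscillatorTripleDictionary (OccursInH1 IsIsoToOmega)
open Summit.HodgeConjecture.HodgeConjecture.Theses (HCCMUnconditional.HDel)
open MulAction
open Literature.Geometry.ComplexHyperbolic.BallModel (U21 x₀)
open Literature.NumberTheory.GelbartRogawski1991.OscillatorTripleDictionary (rhoTriple)
open Summit.HodgeConjecture.CorCM.Lines.A3Liu413 (datum413)
open Summit.HodgeConjecture.HodgeConjecture.Cruxes.H413.CohFormsCarriers
open Literature.NumberTheory.Automorphic.UnitaryGroup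
open Literature.NumberTheory.Automorphic.UnitaryGroup.CotangentForms (toQuotFun cmArchSection cmCompactFactor)
open Summit.HodgeConjecture.HodgeConjecture.Cruxes.H413.F0P3SpectralJunction
open Summit.HodgeConjecture.HodgeConjecture.Cruxes.H413.F0P3HilbertProjection
open Summit.HodgeConjecture.HodgeConjecture.Cruxes.H413.SpectrumJunction (continuous_toQuotFun compactSpace_automorphicQuotient_adelicDatum)


set_option synthInstance.maxHeartbeats 400000 in
set_option maxHeartbeats 8000000 in
/-- **STUB S5 FROM THE LETTERS BY NAME**: Hodge-type exclusion at the pin from E2′ (`hodgeTypeRigid`), (D) (`holCotFormSpectralProjection`,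
`antiholCotFormSpectralProjection`) and the continuity of cotangent forms; = `stubS5_of_spectralProjection hE2' hDh hDa hcont`.
HC_CM is proved only modulo the printed citations until rung 0 closes. [cite: Rogawski1990, Thm. 13.3.6 (c); §15.3 ¶1; §12.3 p. 174; Thm. 14.6.4;
Thm. 13.3.5] [cite: BorelJacquet1979, §4.6] [cite: Borel1997, Thm. 2.13 and §8.4] [cite: Liu2021, proof of Prop. 4.13, l. 2140–2146; Lem. D.2 (2)] -/
theorem stubS5_of_letters (hE2' : Literature.NumberTheory.Rogawski1990.hodgeTypeRigid)
    (hDh : Literature.NumberTheory.Automorphic.UnitaryGroup.CotangentForms.holCotFormSpectralProjection)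
    (hDa : Literature.NumberTheory.Automorphic.UnitaryGroup.CotangentForms.antiholCotFormSpectralProjection)
    (hcont : ∀ (F : HodgeCM.CMField) {ι₁ : F →+* ℂ} (V : HodgeCM.HermSpace3 F ι₁), 4 ≤ Module.finrank ℚ F →
      ∀ f ∈ cohForms (archFactorOf F V), ∀ j : Fin 2, Continuous fun x => f x j) :
    ∀ (hDel : Literature.AlgebraicGeometry.ShimuraVarieties.UnitaryCanonicalModel.canonicalModel_exists_printed)
      (F : HodgeCM.CMField) [IsGalois ℚ F] (h6 : 6 ≤ Module.finrank ℚ F) {ι₁ : F →+* ℂ} (V : HodgeCM.HermSpace3 F ι₁) (a₀ : RealScalar F)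
      (Φ : CMType F) (hΦ : ι₁ ∈ Φ.1) (i : (I V (repAt a₀) (muLiu ι₁ GramClass.rep))),
      3 ≤ (datum413 hDel F V a₀ Φ i).n → ∀ t : (datum413 hDel F V a₀ Φ i).AdmTriple,
        (∀ ψ : (datum413 hDel F V a₀ Φ i).omegaAt t →ₗ[ℂ] ((adelicDatum F V).Adelic → (Fin 2 → ℂ)),
            (∀ (g : ↥(HodgeCM.HermSpace3.adelicFin V)) (w : (datum413 hDel F V a₀ Φ i).omegaAt t),
                ψ ((datum413 hDel F V a₀ Φ i).rhoAt t g w) = rightRep F V g (ψ w)) →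
              (∀ w, ψ w ∈ holCotForms (archFactorOf F V)) → ψ = 0) ∨
        (∀ ψ : (datum413 hDel F V a₀ Φ i).omegaAt t →ₗ[ℂ] ((adelicDatum F V).Adelic → (Fin 2 → ℂ)),
            (∀ (g : ↥(HodgeCM.HermSpace3.adelicFin V)) (w : (datum413 hDel F V a₀ Φ i).omegaAt t),
                ψ ((datum413 hDel F V a₀ Φ i).rhoAt t g w) = rightRep F V g (ψ w)) →
              (∀ w, ψ w ∈ (holCotForms (archFactorOf F V)).map (conjFun F V)) → ψ = 0) :=
  stubS5_of_spectralProjection hE2' hDh hDa hcont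

end Summit.HodgeConjecture.HodgeConjecture.Cruxes.H413.F0P3StubS5Fold

end
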